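import Mathlib
import HarnessLib
import Summits.RiemannHypothesis.RiemannHypothesis.Theorems.DbrWallAntipersistence

/-!
# DBR column, rung B-P(P1): SHARPNESS of the wall anti-persistence — the archimedean two-point gap
# changes sign just beyond the prime-free wall

RH-FREE certified inequality (LINE 1 of the label discipline): a finite fact about the explicit
archimedean–Lerch series of Suzuki2023 (1.1); NOT worded as, and not, progress toward RH.

Companion of `DbrWallAntipersistence` (`zetaScrew_two_mul_lt_two_mul`: `Ψ(2s) < 2Ψ(s)` for all
`0 < s ≤ (log 2)/2`, via the gap `D(s) = Σ_{k≥0}(1 − e^{−λ'_k s})²/λ'_k² − 4(e^{s/2} − 1)²`, `λ'_k = 2k + 5/2`,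
which equals `2Ψ(s) − Ψ(2s)` exactly while `2s ≤ log 2`). Here: **`D(2 log(11/9)) < 0`**
(`gap_two_log_eleven_ninths_neg`; `2 log(11/9) = 0.40134…`, numerically `D = −0.0136`; `D` changes sign at
`s ≈ 0.384`). READING: continued past the wall, the archimedean part of the screw line ALONE would become
persistent (`κ₁ < 0`) by mesh `0.40`; the actual `Ψ` is anti-persistent there — kernel-certified at the
neighbouring mesh `s = log(3/2) = 0.405…` by `DbrLattice.zetaScrew_two_mul_log_lt_two_mul 3 2` — because the
prime `2` enters `Ψ(2s)` at `2s = log 2` with slope `−Λ(2)/√2`, lowering `Ψ(2s)`. This is the two-point analogue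
of the prime-free positivity radius of the zeta string (HOME `run/shared/lean/pub/rh-dbr/DATA.md` §ET6: the
truncated Weil–Kreĭn form loses positivity at `ℓ*(∅) = 0.7432` without the primes). Nothing here bears on the
truth of RH.

Method [folklore]: at `s = 2 log a` every exponential is a power of `a⁻¹` (`e^{−λ'_k s} = a^{−(4k+5)}`,
`e^{s/2} = a`), so with `a = 11/9` ten terms of the series are exact rationals and the tail is majorised by
`Σ_{k≥10} λ'_k⁻² ≤ ¼ Σ_{k≥0} 1/((k+10)(k+11)) = 1/40` (telescoping, `hasSum_inv_mul_succ_ten`):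
`D ≤ 0.1608 + 0.025 < 4(2/9)² = 0.1975`. References: M. Suzuki, J. Lond. Math. Soc. (2) 108 (2023) =
arXiv:2206.03682, (1.1) [Suzuki2023].
-/

set_option linter.dupNamespace false

noncomputable section

open scoped BigOperators
open Set

namespace Summit.RiemannHypothesis.RiemannHypothesis.Theorems.DbrWall

open Literature.NumberTheory.LFunctions

/-! ### Sharpness: the archimedean gap changes sign just beyond the wall -/

/-- Telescoping majorant for the series tail: `Σ_{k≥0} 1/((k+10)(k+11)) = 1/10`. [folklore] -/
theorem hasSum_inv_mul_succ_ten :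
    HasSum (fun k : ℕ => 1 / (((k : ℝ) + 10) * ((k : ℝ) + 11))) (1 / 10) := by
  rw [hasSum_iff_tendsto_nat_of_nonneg (fun k => by positivity)]
  have hf : ∀ n : ℕ, ∑ i ∈ Finset.range n, 1 / (((i : ℝ) + 10) * ((i : ℝ) + 11))
      = 1 / 10 - 1 / ((n : ℝ) + 10) := by
    intro n
    have hi : ∀ i : ℕ, 1 / (((i : ℝ) + 10) * ((i : ℝ) + 11))
        = 1 / ((i : ℝ) + 10) - 1 / (((i + 1 : ℕ) : ℝ) + 10) := by
      intro i
      have h1 : ((i : ℝ) + 10) ≠ 0 := by positivity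
      have h2 : ((i : ℝ) + 11) ≠ 0 := by positivity
      have h3 : (((i + 1 : ℕ) : ℝ) + 10) ≠ 0 := by positivity
      push_cast
      field_simp
      ring
    rw [Finset.sum_congr rfl fun i _ => hi i,
      Finset.sum_range_sub' (fun i : ℕ => 1 / ((i : ℝ) + 10)) n]
    push_cast
    ring
  rw [show (fun n : ℕ => ∑ i ∈ Finset.range n, 1 / (((i : ℝ) + 10) * ((i : ℝ) + 11)))
      = fun n : ℕ => 1 / 10 - 1 / ((n : ℝ) + 10) from funext hf]
  have hlim : Filter.Tendsto (fun n : ℕ => 1 / ((n : ℝ) + 10)) Filter.atTop (nhds 0) := by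
    have h := (Filter.tendsto_add_atTop_iff_nat 9).2 (tendsto_one_div_add_atTop_nhds_zero_nat (𝕜 := ℝ))
    refine h.congr fun n => ?_
    push_cast
    ring_nf
  simpa using tendsto_const_nhds.sub hlim

/-- **Sharpness**: the archimedean gap is NEGATIVE at `s = 2 log(11/9) = 0.40134…` (`> (log 2)/2`):
`D(2 log(11/9)) = Σ_k (1 − (9/11)^{4k+5})²/λ'_k² − 4(2/9)² < 0` (ten terms + the tail majorant
`Σ_{k≥10} λ'_k⁻² ≤ ¼ Σ_{k≥0} 1/((k+10)(k+11)) = 1/40`; numerically `D = −0.0136`). Past the wall the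
archimedean–Lerch part of `Ψ` alone would make the lattice screw line persistent; `2Ψ(s) − Ψ(2s)` itself is
positive at the neighbouring mesh `log(3/2)` (`DbrLattice.zetaScrew_two_mul_log_lt_two_mul 3 2`) because the
prime `2` has entered `Ψ(2s)`. [folklore] -/
theorem gap_two_log_eleven_ninths_neg :
    (∑' k : ℕ, (1 - Real.exp (-((2 * (k : ℝ) + 5 / 2) * (2 * Real.log (11 / 9))))) ^ 2
        / (2 * (k : ℝ) + 5 / 2) ^ 2)
      - 4 * (Real.exp (2 * Real.log (11 / 9) / 2) - 1) ^ 2 < 0 := by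
  have hlog : 0 < Real.log (11 / 9) := Real.log_pos (by norm_num)
  have ha : Real.exp (2 * Real.log (11 / 9) / 2) = 11 / 9 := by
    rw [mul_div_cancel_left₀ _ (two_ne_zero' ℝ), Real.exp_log (by norm_num)]
  have he : ∀ k : ℕ, Real.exp (-((2 * (k : ℝ) + 5 / 2) * (2 * Real.log (11 / 9)))) = (9 / 11 : ℝ) ^ (4 * k + 5) := by
    intro k
    rw [show (2 * (k : ℝ) + 5 / 2) * (2 * Real.log (11 / 9)) = ((4 * k + 5 : ℕ) : ℝ) * Real.log (11 / 9) by
      push_cast; ring, Real.exp_neg, Real.exp_nat_mul, Real.exp_log (by norm_num),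
      ← inv_pow]
    norm_num
  have hS : Summable fun k : ℕ => (1 - (9 / 11 : ℝ) ^ (4 * k + 5)) ^ 2 / (2 * (k : ℝ) + 5 / 2) ^ 2 := by
    have := summable_gap_terms (s := 2 * Real.log (11 / 9)) (by positivity)
    simp only [he] at this
    exact this
  simp only [he]
  rw [ha, ← hS.sum_add_tsum_nat_add 10]
  -- the tail
  have hT : Summable fun k : ℕ => (1 / 4 : ℝ) * (1 / (((k : ℝ) + 10) * ((k : ℝ) + 11))) :=
    (hasSum_inv_mul_succ_ten.mul_left (1 / 4)).summable
  have hTval : ∑' k : ℕ, (1 / 4 : ℝ) * (1 / (((k : ℝ) + 10) * ((k : ℝ) + 11))) = 1 / 40 := by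
    rw [(hasSum_inv_mul_succ_ten.mul_left (1 / 4)).tsum_eq]; norm_num
  have htail : ∑' k : ℕ, (1 - (9 / 11 : ℝ) ^ (4 * (k + 10) + 5)) ^ 2 / (2 * ((k + 10 : ℕ) : ℝ) + 5 / 2) ^ 2
      ≤ ∑' k : ℕ, (1 / 4 : ℝ) * (1 / (((k : ℝ) + 10) * ((k : ℝ) + 11))) := by
    refine ((summable_nat_add_iff 10).2 hS).tsum_le_tsum (fun k => ?_) hT
    have hq0 : 0 ≤ (9 / 11 : ℝ) ^ (4 * (k + 10) + 5) := by positivity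
    have hq1 : (9 / 11 : ℝ) ^ (4 * (k + 10) + 5) ≤ 1 := pow_le_one₀ (by norm_num) (by norm_num)
    have hnum : (1 - (9 / 11 : ℝ) ^ (4 * (k + 10) + 5)) ^ 2 ≤ 1 := by nlinarith
    have hlam : (2 * ((k + 10 : ℕ) : ℝ) + 5 / 2) ^ 2 = (2 * (k : ℝ) + 45 / 2) ^ 2 := by push_cast; ring
    rw [hlam, div_le_iff₀ (by positivity)]
    have hk : (0 : ℝ) ≤ k := Nat.cast_nonneg k
    have h10 : (0 : ℝ) < ((k : ℝ) + 10) * ((k : ℝ) + 11) := by positivity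
    calc (1 - (9 / 11 : ℝ) ^ (4 * (k + 10) + 5)) ^ 2 ≤ 1 := hnum
      _ ≤ (1 / 4 : ℝ) * (1 / (((k : ℝ) + 10) * ((k : ℝ) + 11))) * (2 * (k : ℝ) + 45 / 2) ^ 2 := by
          have hre : (1 / 4 : ℝ) * (1 / (((k : ℝ) + 10) * ((k : ℝ) + 11))) * (2 * (k : ℝ) + 45 / 2) ^ 2
              = (2 * (k : ℝ) + 45 / 2) ^ 2 / (4 * (((k : ℝ) + 10) * ((k : ℝ) + 11))) := by
            field_simp
          rw [hre, le_div_iff₀ (by positivity)]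
          nlinarith
  rw [hTval] at htail
  -- ten terms, exact rationals
  have hnum : ∑ k ∈ Finset.range 10, (1 - (9 / 11 : ℝ) ^ (4 * k + 5)) ^ 2 / (2 * (k : ℝ) + 5 / 2) ^ 2
      + 1 / 40 < 4 * (11 / 9 - 1) ^ 2 := by
    simp only [Finset.sum_range_succ, Finset.sum_range_zero]
    norm_num
  linarith

/-- **Beyond mesh `2 log(11/9)` the archimedean gap is negative at EVERY mesh**: for all `s ≥ 2 log(11/9) = 0.4013…`,
`Σ_k(1 − e^{−λ'_k s})²/λ'_k² − 4(e^{s/2} − 1)² < 0`. Negativity propagates upward by the scaling law of p440661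
(`gap_scaling`: `(s/s')²·D(s') ≤ D(s)` for `s ≤ s'`). So past the wall ALL anti-persistence of the lattice screw line
(`κ₁ > 0`, certified through `(log 5)/2` in `DbrWallAntipersistenceLogFive` and at the 55 meshes of
`DbrLatticeAntipersistence`) is owed to the prime ramps `φ(2s) − 2φ(s)` of `two_mul_zetaScrew_sub_eq_gap_add_primeSums`.
[folklore] -/
theorem gap_neg_of_two_log_eleven_ninths_le {s : ℝ} (hs : 2 * Real.log (11 / 9) ≤ s) :
    (∑' k : ℕ, (1 - Real.exp (-((2 * (k : ℝ) + 5 / 2) * s))) ^ 2 / (2 * (k : ℝ) + 5 / 2) ^ 2)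
      - 4 * (Real.exp (s / 2) - 1) ^ 2 < 0 := by
  have h0 : 0 < 2 * Real.log (11 / 9) := by
    have := Real.log_pos (show (1 : ℝ) < 11 / 9 by norm_num); linarith
  have hneg := gap_two_log_eleven_ninths_neg
  have hsc := gap_scaling h0 hs
  have hq : 0 < (2 * Real.log (11 / 9) / s) ^ 2 := by
    have : 0 < s := lt_of_lt_of_le h0 hs
    positivity
  -- `(s₀/s)²·D(s) ≤ D(s₀) < 0` with `(s₀/s)² > 0`
  by_contra hcon
  push Not at hcon
  have : 0 ≤ (2 * Real.log (11 / 9) / s) ^ 2 *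
      ((∑' k : ℕ, (1 - Real.exp (-((2 * (k : ℝ) + 5 / 2) * s))) ^ 2 / (2 * (k : ℝ) + 5 / 2) ^ 2)
        - 4 * (Real.exp (s / 2) - 1) ^ 2) := mul_nonneg hq.le hcon
  linarith

end Summit.RiemannHypothesis.RiemannHypothesis.Theorems.DbrWall
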